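import Summits.CriticalPhenomena.CardyFormulaZ2.Theorems.CardyComplexConeEdgeCoherenceStubFactorisationEntry
import Literature.Probability.LatticeModels.MeshDomainJordan

/-!
# Stub `stub_factorisation` of line `Sketch` (composition `FixedRadiusCut`) for crux `CardyComplexCone.EdgeCoherence`
(item stmt-CriticalPhenomena-11385) — exact first-entry factorisation with explicit weights and remainder

Helper file `--supports stmt-CriticalPhenomena-11385`; proves the registered stub
`stub_factorisation : Sig.stub_factorisation` by name (module 4 of 4; modules `…StubFactorisationLocal`,
`…Orbit`, `…Entry` carry the lemmas).

**Statement.** For every Dobrushin domain `D`, family `Λ` (guards `(Λ δ).Ω = D.carrier`, `(Λ δ).δ = δ`,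
eventual admissibility), compact `K ⊆ D.carrier` and radius `ρ`, eventually as `δ → 0⁺`, at every site `v`
with `δ v ∈ K`: the outer weight `entryWeight ρ (Λ δ) v` is finitely supported on labels with entry vertex
outside `B(0, ρ)`, and for every class `c`,
`cornerObs (Λ δ) δ v (faceAt v c) = Σᶠ_l entryWeight ρ (Λ δ) v l · innerResp ρ l.1 l.2 c + remainderObs ρ (Λ δ) v c`.

**Proof outline.**
1. *Eventually*: admissibility (guard), `δ > 0`, and the interior hypothesis for `B(v, ρ)` — from
   `JordanDomain.eventually_forall_mem_meshDomain'` applied to the closed `r`-thickening of `K` inside the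
   open carrier (`IsCompact.exists_cthickening_subset_open`) and `2(ρ+2)δ ≤ r` (segments between mesh points
   of neighbouring sites near `v` stay in that thickening, by convexity of balls).
2. *Orbit form* (module 2): the integrand of `cornerObs` is `Σ_{k<len-1} [orbit k = (v,c)] orbitPhase k`; split
   `[·] = [· ∧ FirstExcursion] + [· ∧ ¬FirstExcursion]`; the second part integrates to `remainderObs`
   (definitionally), both parts being integrable as functionals of the finitely many edges of `Ω_δ`.
3. *Pathwise first-excursion identity* (module 3): the first part is `Σ_l OW_l(ω) · IW_l(ω - v)` over the finite
   label set, `OW_l` the integrand of `entryWeight l`, `IW_l` the integrand of `innerResp ρ l.1 l.2 c`.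
4. *Independence*: `OW_l` reads only pairs with a member outside the ball (`outer_local`: the exploration up
   to one step after the entry time queries only such target edges; the entry time, the exit-before-entry
   condition, the label and the entry phase are functions of that prefix), `IW_l(· - v)` reads only
   inner–inner pairs (`mixCfg_translate_inter`); both are measurable (local functionals), so
   `E[OW_l · IW_l(· - v)] = E[OW_l] · E[IW_l(· - v)] = entryWeight l · innerResp ρ l.1 l.2 c` by the product
   formula and translation invariance of `P_{1/2}` (module 1).
5. Labels outside the finite admissible set have `entryWeight = 0`, whence the support claims and `Σᶠ = Σ`.

Measurability / integrability (the lead's Q2): for admissible data every integrand met here (`cornerObs`,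
`entryWeight`, `remainderObs`, and `innerResp` after translation) is a functional of finitely many pairs
(the edges of `Ω_δ`, resp. the inner–inner pairs of the ball), hence measurable, bounded and integrable
(module 1); no junk `0` Bochner integral occurs.

Sources: H. Duminil-Copin, S. Smirnov, *Conformal invariance of lattice models*, Clay Math. Proc. 15 (2012)
§8 (Conj. 8.7, the `q = 1` spin-`1/3` observable); S. Smirnov, Ann. of Math. 172 (2010) §2.2; G. Grimmett,
*Percolation* (1999) §1.3, §1.6; idea card `Cruxes/EdgeCoherence/Ideas/fixed-radius-equivariant-cut.md`.
-/

noncomputable section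

namespace Summit.CriticalPhenomena.CardyFormulaZ2.Cruxes.EdgeCoherence.FixedRadiusCut

open scoped BigOperators Topology
open Filter Set MeasureTheory ProbabilityTheory
open Literature.Probability.LatticeModels Literature.Probability.RandomPlanarGeometry
open Literature.Probability.Percolation

/-! ## §5 (continued) Locality of the outer weight; assembly at fixed admissible data -/

section Assembly


open Summit.CriticalPhenomena.CardyFormulaZ2.Theorems.EdgeCoherence.Negative (dartPhaseSum)

variable {E : DiscreteDobrushin} (hE : E.IsZdAdmissible) {v : Site 2} {ρ : ℕ}
  (hgeo : ∀ x y : Site 2, (∀ i, |x i - v i| ≤ ρ + 2) → (∀ i, |y i - v i| ≤ ρ + 2) →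
      (zdGraph 2).Adj x y → (discreteDomainGraph E.Ω E.δ).Adj x y)

/-! Local abbreviations (notation only, expanded at parse time): the completed configuration
`𝔅⟦ω⟧`, its orbit `𝔒⟦ω⟧` from the start corner, the entry time `𝔱⟦ω⟧` into `B(v,ρ)`, the
translation `𝔗` by `-v`, the quenched translated configuration `𝔐⟦ω⟧` and the centred entry
corner `𝔢⟦ω⟧`. -/

local notation "𝔅⟦" ω "⟧" => DiscreteDobrushin.bcBondConfig E ω
local notation "𝔒⟦" ω "⟧" => cornerOrbit (DiscreteDobrushin.bcBondConfig E ω) (startCorner E)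
local notation "𝔱⟦" ω "⟧" =>
  entryTime ρ v (cornerOrbit (DiscreteDobrushin.bcBondConfig E ω) (startCorner E))
local notation "𝔗" => BondConfig.relabel (sym2Equiv (Site.shift (-v)))
local notation "𝔐⟦" ω "⟧" =>
  mixCfg ρ ((fun e : Sym2 (Site 2) => Sym2.map (fun x : Site 2 => x - v) e) ''
      (DiscreteDobrushin.bcBondConfig E ω ∩ cutEdgesAt ρ v))
    (BondConfig.relabel (sym2Equiv (Site.shift (-v))) ω)
local notation "𝔢⟦" ω "⟧" =>
  (Prod.fst (cornerOrbit (DiscreteDobrushin.bcBondConfig E ω) (startCorner E)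
      (entryTime ρ v (cornerOrbit (DiscreteDobrushin.bcBondConfig E ω) (startCorner E)))) - v,
    Prod.snd (cornerOrbit (DiscreteDobrushin.bcBondConfig E ω) (startCorner E)
      (entryTime ρ v (cornerOrbit (DiscreteDobrushin.bcBondConfig E ω) (startCorner E)))))

include hE hgeo

/-! ### Locality of the outer weight, the inner functional and the remainder -/

omit hE hgeo in
/-- Entry times compare along agreeing orbit prefixes: if `o₂` agrees with `o₁` up to one step
after the entry time of `o₁`, then `o₁` enters no later than `o₂`. -/
theorem entryTime_le_of_agree {o₁ o₂ : ℕ → Site 2 × Fin 4}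
    (h : ∀ j ≤ entryTime ρ v o₁ + 1, o₂ j = o₁ j) : entryTime ρ v o₁ ≤ entryTime ρ v o₂ := by
  by_contra hlt
  push Not at hlt
  have h2 : ¬ InBall ρ ((o₂ (entryTime ρ v o₂ + 1)).1 - v) := by
    rw [h _ (by omega)]
    exact Nat.notMem_of_lt_sInf hlt
  rcases Set.eq_empty_or_nonempty {t | InBall ρ ((o₂ (t + 1)).1 - v)} with he | hne
  · have h0 : entryTime ρ v o₂ = 0 := by unfold entryTime; rw [he, Nat.sInf_empty]
    rcases Set.eq_empty_or_nonempty {t | InBall ρ ((o₁ (t + 1)).1 - v)} with he1 | hne1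
    · have : entryTime ρ v o₁ = 0 := by unfold entryTime; rw [he1, Nat.sInf_empty]
      omega
    · have hmem : InBall ρ ((o₁ (entryTime ρ v o₁ + 1)).1 - v) := Nat.sInf_mem hne1
      rw [← h _ le_rfl] at hmem
      have : entryTime ρ v o₁ ∈ {t | InBall ρ ((o₂ (t + 1)).1 - v)} := hmem
      rw [he] at this
      exact this
  · exact h2 (Nat.sInf_mem hne)


/-! More local abbreviations: the integrands of `entryWeight` (`OW⟦l⟧`), of `remainderObs`
(`RE⟦c⟧`), the first-excursion sum (`FE⟦c⟧`) and the integrand of `innerResp` (`IW⟦l, c⟧`). -/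

local notation "OW⟦" l "⟧" => fun ω' : BondConfig (Site 2) =>
  ite (InBall ρ (Prod.fst (𝔒⟦ω'⟧ (𝔱⟦ω'⟧ + 1)) - v) ∧
      𝔱⟦ω'⟧ + 1 < List.length (medialExploration E ω') ∧ entryLabel ρ v 𝔅⟦ω'⟧ 𝔒⟦ω'⟧ = l)
    (orbitPhase 𝔅⟦ω'⟧ (startCorner E) 𝔱⟦ω'⟧) (0 : ℂ)
local notation "RE⟦" c "⟧" => fun ω' : BondConfig (Site 2) =>
  ∑ k ∈ Finset.range (List.length (medialExploration E ω') - 1),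
    ite (𝔒⟦ω'⟧ k = (v, c) ∧ ¬ FirstExcursion ρ v 𝔒⟦ω'⟧ k) (orbitPhase 𝔅⟦ω'⟧ (startCorner E) k)
      (0 : ℂ)
local notation "FE⟦" c "⟧" => fun ω' : BondConfig (Site 2) =>
  ∑ k ∈ Finset.range (List.length (medialExploration E ω') - 1),
    ite (𝔒⟦ω'⟧ k = (v, c) ∧ FirstExcursion ρ v 𝔒⟦ω'⟧ k) (orbitPhase 𝔅⟦ω'⟧ (startCorner E) k)
      (0 : ℂ)
local notation "IW⟦" l "," c "⟧" => fun ω' : BondConfig (Site 2) =>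
  ∑ n ∈ Finset.range (hitBound ρ),
    ite (InnerHit ρ (mixCfg ρ (Prod.fst l) ω') (Prod.snd l) c n)
      (orbitPhase (mixCfg ρ (Prod.fst l) ω') (Prod.snd l) n) (0 : ℂ)

open scoped Classical in
/-- **The outer weight reads only the outer edges.** The integrand of `entryWeight` takes the
same value on `ω` and on `ω ∩ O`, `O` the set of pairs with a member outside `B(v, ρ)`: the
exploration up to one step after the entry time queries only target edges at vertices outside
the ball, the exit-before-entry condition is a condition on those corners' faces, and the label
and the entry phase are read off the same data. -/
theorem outer_local (ω : BondConfig (Site 2)) (l : BondConfig (Site 2) × (Site 2 × Fin 4)) :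
    (OW⟦l⟧) (ω ∩ {e : Sym2 (Site 2) | ∃ x ∈ e, ¬ InBall ρ (x - v)}) = (OW⟦l⟧) ω := by
  have hc₀ := isStartCorner_startCorner hE
  have hag : ∀ e ∈ {e : Sym2 (Site 2) | ∃ x ∈ e, ¬ InBall ρ (x - v)},
      e ∈ 𝔅⟦ω ∩ {e : Sym2 (Site 2) | ∃ x ∈ e, ¬ InBall ρ (x - v)}⟧ ↔ e ∈ 𝔅⟦ω⟧ :=
    fun e he => mem_bcBondConfig_inter_iff ω he
  have htgt : ∀ p : Site 2 × Fin 4, ¬ InBall ρ (p.1 - v) →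
      cTgt p ∈ {e : Sym2 (Site 2) | ∃ x ∈ e, ¬ InBall ρ (x - v)} :=
    fun p hp => ⟨p.1, Sym2.mem_mk_left _ _, hp⟩
  set ω' := ω ∩ {e : Sym2 (Site 2) | ∃ x ∈ e, ¬ InBall ρ (x - v)} with hω'
  have hA1 : ∀ j ≤ 𝔱⟦ω⟧ + 1, 𝔒⟦ω'⟧ j = 𝔒⟦ω⟧ j :=
    cornerOrbit_congr' (startCorner E) fun i hi =>
      hag _ (htgt _ (not_inBall_of_le_entryTime hE hgeo ω (by omega)))
  have hA2 : ∀ j ≤ 𝔱⟦ω'⟧ + 1, 𝔒⟦ω⟧ j = 𝔒⟦ω'⟧ j :=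
    cornerOrbit_congr' (startCorner E) fun i hi =>
      (hag _ (htgt _ (not_inBall_of_le_entryTime hE hgeo ω' (by omega)))).symm
  have ht : 𝔱⟦ω'⟧ = 𝔱⟦ω⟧ := le_antisymm (entryTime_le_of_agree hA2) (entryTime_le_of_agree hA1)
  have hstat : ∀ i ≤ 𝔱⟦ω⟧, (cTgt (𝔒⟦ω⟧ i) ∈ 𝔅⟦ω'⟧ ↔ cTgt (𝔒⟦ω⟧ i) ∈ 𝔅⟦ω⟧) := fun i hi =>
    hag _ (htgt _ (not_inBall_of_le_entryTime hE hgeo ω hi))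
  refine if_congr ?_ ?_ rfl
  · rw [ht, hA1 _ le_rfl, succ_lt_length_iff hE hc₀ ω', succ_lt_length_iff hE hc₀ ω]
    refine and_congr Iff.rfl (and_congr (forall₂_congr fun k hk => by rw [hA1 k (by omega)]) ?_)
    rw [show entryLabel ρ v 𝔅⟦ω'⟧ 𝔒⟦ω'⟧ = entryLabel ρ v 𝔅⟦ω⟧ 𝔒⟦ω⟧ from ?_]
    unfold entryLabel
    rw [ht, hA1 _ (by omega)]
    congr 2
    ext e
    simp only [Set.mem_inter_iff]
    constructor
    · rintro ⟨h1, h2⟩; exact ⟨(hag e h2.2).1 h1, h2⟩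
    · rintro ⟨h1, h2⟩; exact ⟨(hag e h2.2).2 h1, h2⟩
  · rw [ht]
    simp only [orbitPhase]
    congr 4
    refine Finset.sum_congr rfl fun i hi => ?_
    rw [Finset.mem_range] at hi
    rw [hA1 i (by omega)]
    unfold turnSign
    rw [if_congr (hstat i (by omega)) rfl rfl]

omit hE hgeo in
open scoped Classical in
/-- The outer weight reads `ω` only on the edges of `Ω_δ` (through `bcBondConfig` and the
exploration). -/
theorem outer_edgeSet_local (ω : BondConfig (Site 2)) (l : BondConfig (Site 2) × (Site 2 × Fin 4)) :
    (OW⟦l⟧) (ω ∩ (discreteDomainGraph E.Ω E.δ).edgeSet) = (OW⟦l⟧) ω := by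
  beta_reduce
  rw [medialExploration_inter_edgeSet ω, bcBondConfig_inter_edgeSet]

omit hE hgeo in
open scoped Classical in
/-- The first-excursion sum reads `ω` only on the edges of `Ω_δ`. -/
theorem firstExc_edgeSet_local (ω : BondConfig (Site 2)) (c : Fin 4) :
    (FE⟦c⟧) (ω ∩ (discreteDomainGraph E.Ω E.δ).edgeSet) = (FE⟦c⟧) ω := by
  beta_reduce
  rw [medialExploration_inter_edgeSet ω, bcBondConfig_inter_edgeSet]

omit hE hgeo in
open scoped Classical in
/-- The remainder sum reads `ω` only on the edges of `Ω_δ`. -/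
theorem rem_edgeSet_local (ω : BondConfig (Site 2)) (c : Fin 4) :
    (RE⟦c⟧) (ω ∩ (discreteDomainGraph E.Ω E.δ).edgeSet) = (RE⟦c⟧) ω := by
  beta_reduce
  rw [medialExploration_inter_edgeSet ω, bcBondConfig_inter_edgeSet]

/-! ### Assembly at fixed admissible data -/

open scoped Classical in
/-- Labels outside the admissible label set carry zero outer weight. -/
theorem entryWeight_eq_zero_of_not_mem (l : BondConfig (Site 2) × (Site 2 × Fin 4))
    (hl : l ∉ {l : BondConfig (Site 2) × (Site 2 × Fin 4) |
        l.1 ⊆ {e | e ∈ (zdGraph 2).edgeSet ∧ e ∈ cutEdgesAt ρ 0} ∧ ¬ InBall ρ l.2.1 ∧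
          ∃ k : Fin 4, InBall ρ (l.2.1 + cornerUnit k)}) :
    entryWeight ρ E v l = 0 := by
  show (∫ ω, (OW⟦l⟧) ω ∂(bondPercolation (zdGraph 2) half)) = 0
  have : (OW⟦l⟧) = fun _ => 0 := by
    funext ω
    rw [if_neg]
    rintro ⟨hA, -, rfl⟩
    exact hl (entryLabel_mem hE hgeo ω hA)
  rw [this, integral_zero]

open scoped Classical in
/-- **The factorisation at fixed admissible data.** For admissible `E`, a nonzero reading mesh
`δ`, and a ball `B(v, ρ)` satisfying the interior hypothesis, the corner observable at
`(v, faceAt v c)` is the finite sum `Σ_l entryWeight l · innerResp ρ l.1 l.2 c` over any finite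
set of labels containing the admissible ones, plus the remainder. -/
theorem cornerObs_eq_sum {δ : ℝ} (hδ0 : δ ≠ 0) (c : Fin 4)
    (Lf : Finset (BondConfig (Site 2) × (Site 2 × Fin 4)))
    (hLf : {l : BondConfig (Site 2) × (Site 2 × Fin 4) |
        l.1 ⊆ {e | e ∈ (zdGraph 2).edgeSet ∧ e ∈ cutEdgesAt ρ 0} ∧ ¬ InBall ρ l.2.1 ∧
          ∃ k : Fin 4, InBall ρ (l.2.1 + cornerUnit k)} ⊆ ↑Lf) :
    cornerObs E δ v (faceAt v c) =
      (∑ l ∈ Lf, entryWeight ρ E v l * innerResp ρ l.1 l.2 c) + remainderObs ρ E v c := by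
  have hc₀ := isStartCorner_startCorner hE
  have hS := edgeSet_finite hE
  have hI := innerPairs_finite (ρ := ρ) (v := v)
  -- pointwise split of the integrand into first-excursion part and remainder
  have hpt : ∀ ω, dartPhaseSum (medialExploration E ω) δ v (faceAt v c) = (FE⟦c⟧) ω + (RE⟦c⟧) ω := by
    intro ω
    have h := dartPhaseSum_eq_sum_orbitPhase hE hc₀ hδ0 ω (v, c)
    dsimp only at h
    beta_reduce
    rw [show faceAt v c = cFace (v, c) from rfl, h, ← Finset.sum_add_distrib]
    refine Finset.sum_congr rfl fun k _ => ?_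
    by_cases h1 : 𝔒⟦ω⟧ k = (v, c) <;> by_cases h2 : FirstExcursion ρ v 𝔒⟦ω⟧ k <;> simp [h1, h2]
  have hFEi : Integrable (FE⟦c⟧) (bondPercolation (zdGraph 2) half) :=
    integrable_of_forall_inter hS (fun ω => (firstExc_edgeSet_local ω c).symm) _ _
  have hREi : Integrable (RE⟦c⟧) (bondPercolation (zdGraph 2) half) :=
    integrable_of_forall_inter hS (fun ω => (rem_edgeSet_local ω c).symm) _ _
  have hsplit : cornerObs E δ v (faceAt v c) =
      (∫ ω, (FE⟦c⟧) ω ∂(bondPercolation (zdGraph 2) half)) +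
        ∫ ω, (RE⟦c⟧) ω ∂(bondPercolation (zdGraph 2) half) := by
    rw [← integral_add hFEi hREi]
    exact integral_congr_ae (ae_of_all _ hpt)
  -- the first-excursion part as a finite sum over labels of outer × inner
  have hFE : ∀ ω, (FE⟦c⟧) ω = ∑ l ∈ Lf, (OW⟦l⟧) ω * (IW⟦l, c⟧) (𝔗 ω) := by
    intro ω
    have h := firstExcursion_sum_eq hE hgeo ω c
    beta_reduce
    rw [h]
    by_cases hA : InBall ρ ((𝔒⟦ω⟧ (𝔱⟦ω⟧ + 1)).1 - v) ∧ 𝔱⟦ω⟧ + 1 < (medialExploration E ω).length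
    · rw [if_pos hA, Finset.sum_eq_single_of_mem (entryLabel ρ v 𝔅⟦ω⟧ 𝔒⟦ω⟧)
        (hLf (entryLabel_mem hE hgeo ω hA.1))]
      · rw [if_pos ⟨hA.1, hA.2, rfl⟩]
        rfl
      · intro l _ hne
        rw [if_neg, zero_mul]
        rintro ⟨-, -, h⟩
        exact hne h.symm
    · rw [if_neg hA]
      symm
      refine Finset.sum_eq_zero fun l _ => ?_
      rw [if_neg, zero_mul]
      exact fun h => hA ⟨h.1, h.2.1⟩
  have hIWloc : ∀ (l : BondConfig (Site 2) × (Site 2 × Fin 4)) (ω : BondConfig (Site 2)),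
      (IW⟦l, c⟧) (𝔗 (ω ∩ {e : Sym2 (Site 2) | ∀ x ∈ e, InBall ρ (x - v)})) = (IW⟦l, c⟧) (𝔗 ω) := by
    intro l ω
    beta_reduce
    rw [mixCfg_translate_inter]
  have hOWi : ∀ l, Integrable (OW⟦l⟧) (bondPercolation (zdGraph 2) half) := fun l =>
    integrable_of_forall_inter hS (fun ω => (outer_edgeSet_local ω l).symm) _ _
  have hIWm : ∀ l : BondConfig (Site 2) × (Site 2 × Fin 4),
      Measurable fun ω => (IW⟦l, c⟧) (𝔗 ω) := fun l =>
    measurable_of_forall_inter hI (fun ω => (hIWloc l ω).symm)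
  have hprod : ∀ l ∈ Lf, Integrable (fun ω => (OW⟦l⟧) ω * (IW⟦l, c⟧) (𝔗 ω))
      (bondPercolation (zdGraph 2) half) := fun l _ => by
    obtain ⟨C, hC⟩ := exists_norm_le_of_forall_inter hI (fun ω => (hIWloc l ω).symm)
    exact (hOWi l).mul_bdd (hIWm l).aestronglyMeasurable (ae_of_all _ hC)
  have hdisj : Disjoint {e : Sym2 (Site 2) | ∃ x ∈ e, ¬ InBall ρ (x - v)}
      {e : Sym2 (Site 2) | ∀ x ∈ e, InBall ρ (x - v)} :=
    Set.disjoint_left.2 fun e ⟨x, hx, hn⟩ hall => hn (hall x hx)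
  calc cornerObs E δ v (faceAt v c)
      = (∫ ω, (FE⟦c⟧) ω ∂(bondPercolation (zdGraph 2) half)) +
          ∫ ω, (RE⟦c⟧) ω ∂(bondPercolation (zdGraph 2) half) := hsplit
    _ = (∫ ω, ∑ l ∈ Lf, (OW⟦l⟧) ω * (IW⟦l, c⟧) (𝔗 ω) ∂(bondPercolation (zdGraph 2) half)) +
          remainderObs ρ E v c := by
        rw [integral_congr_ae (ae_of_all _ hFE)]
        rfl
    _ = (∑ l ∈ Lf, ∫ ω, (OW⟦l⟧) ω * (IW⟦l, c⟧) (𝔗 ω) ∂(bondPercolation (zdGraph 2) half)) +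
          remainderObs ρ E v c := by
        rw [integral_finsetSum _ hprod]
    _ = (∑ l ∈ Lf, entryWeight ρ E v l * innerResp ρ l.1 l.2 c) + remainderObs ρ E v c := by
        congr 1
        refine Finset.sum_congr rfl fun l _ => ?_
        rw [integral_mul_of_disjoint (zdGraph 2) half hdisj
          (measurable_of_forall_inter hS fun ω => (outer_edgeSet_local ω l).symm) (hIWm l)
          (fun ω => (outer_local hE hgeo ω l).symm) (fun ω => (hIWloc l ω).symm),
          integral_comp_shift (-v) (IW⟦l, c⟧)]
        rfl

end Assembly

/-! ## §6 The stub: eventually in `δ`, the ball `B(v, ρ)` is interior and the factorisation holds -/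

/-- Mesh points of sites within sup-distance `R` of `v` are within `2 R δ` of `meshPoint δ v`. -/
theorem dist_meshPoint_le {δ : ℝ} (hδ : 0 ≤ δ) {R : ℤ} {x v : Site 2} (hx : ∀ i, |x i - v i| ≤ R) :
    dist (meshPoint δ x) (meshPoint δ v) ≤ 2 * R * δ := by
  rw [dist_eq_norm]
  have hre : (meshPoint δ x - meshPoint δ v).re = δ * (x 0 - v 0 : ℤ) := by
    simp [meshPoint_re]; ring
  have him : (meshPoint δ x - meshPoint δ v).im = δ * (x 1 - v 1 : ℤ) := by
    simp [meshPoint_im]; ring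
  refine (Complex.norm_le_abs_re_add_abs_im _).trans ?_
  rw [hre, him, abs_mul, abs_mul, abs_of_nonneg hδ]
  have h0 : |((x 0 - v 0 : ℤ) : ℝ)| ≤ R := by exact_mod_cast hx 0
  have h1 : |((x 1 - v 1 : ℤ) : ℝ)| ≤ R := by exact_mod_cast hx 1
  nlinarith

/-- Registered stub (exact first-entry factorisation with explicit weights and remainder):
for every Dobrushin domain, discretisation family, compact `K ⊆ D` and radius `ρ`, eventually in
`δ`, at every `v` over `K` the outer weight `entryWeight ρ (Λ δ) v` is finitely supported on
labels with entry vertex outside the ball and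
`cornerObs (Λ δ) δ v (faceAt v c) = Σᶠ_l entryWeight l · innerResp ρ l.1 l.2 c + remainderObs ρ (Λ δ) v c`.
"Eventually" supplies admissibility, `δ > 0`, and (via `JordanDomain.eventually_forall_mem_meshDomain'`
applied to a closed thickening of `K` inside `D`) the interior hypothesis for `B(v, ρ)`. -/
theorem stub_factorisation : Sig.stub_factorisation := by
  intro D Λ hΩ hδ hadm K hK hKD ρ
  obtain ⟨r, hr, hrK⟩ := hK.exists_cthickening_subset_open D.isOpen hKD
  have hK' : IsCompact (Metric.cthickening r K) := hK.cthickening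
  have hmesh := D.toJordanDomain.eventually_forall_mem_meshDomain' hK' hrK
  have hsmall : ∀ᶠ δ in 𝓝[>] (0:ℝ), 0 < δ ∧ 2 * ((ρ : ℝ) + 2) * δ ≤ r := by
    have hpos : (0:ℝ) < r / (2 * ((ρ : ℝ) + 2)) := by positivity
    filter_upwards [Ioo_mem_nhdsGT hpos] with δ hδ'
    refine ⟨hδ'.1, ?_⟩
    have := hδ'.2.le
    rwa [le_div_iff₀ (by positivity), mul_comm] at this
  filter_upwards [hadm, hmesh, hsmall] with δ hE hmeshδ hsm v hv
  obtain ⟨hδpos, hδr⟩ := hsm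
  -- the interior hypothesis for `B(v, ρ)` in `Λ δ`
  have hin : ∀ x : Site 2, (∀ i, |x i - v i| ≤ ρ + 2) → meshPoint δ x ∈ Metric.cthickening r K := by
    intro x hx
    refine Metric.mem_cthickening_of_dist_le _ _ _ _ hv ?_
    have := dist_meshPoint_le hδpos.le (R := ρ + 2) hx
    push_cast at this
    linarith
  have hgeo : ∀ x y : Site 2, (∀ i, |x i - v i| ≤ ρ + 2) → (∀ i, |y i - v i| ≤ ρ + 2) →
      (zdGraph 2).Adj x y → (discreteDomainGraph (Λ δ).Ω (Λ δ).δ).Adj x y := by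
    intro x y hx hy hxy
    rw [hΩ δ, hδ δ, discreteDomainGraph_adj_iff, meshGraph_adj_iff]
    refine ⟨⟨hxy, ?_⟩, (hmeshδ.1 x (hin x hx)), (hmeshδ.1 y (hin y hy))⟩
    refine ((convex_closedBall (meshPoint δ v) (2 * ((ρ : ℝ) + 2) * δ)).segment_subset ?_ ?_).trans ?_
    · have := dist_meshPoint_le hδpos.le (R := ρ + 2) hx
      rw [Metric.mem_closedBall]; push_cast at this; linarith
    · have := dist_meshPoint_le hδpos.le (R := ρ + 2) hy
      rw [Metric.mem_closedBall]; push_cast at this; linarith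
    · intro z hz
      rw [Metric.mem_closedBall] at hz
      exact subset_closure (hrK (Metric.mem_cthickening_of_dist_le _ _ _ _ hv (hz.trans hδr)))
  have hfin := labelSet_finite ρ
  have hsupp : (entryWeight ρ (Λ δ) v).support ⊆
      {l : BondConfig (Site 2) × (Site 2 × Fin 4) |
        l.1 ⊆ {e | e ∈ (zdGraph 2).edgeSet ∧ e ∈ cutEdgesAt ρ 0} ∧ ¬ InBall ρ l.2.1 ∧
          ∃ k : Fin 4, InBall ρ (l.2.1 + cornerUnit k)} := fun l hl => by
    by_contra h
    exact hl (entryWeight_eq_zero_of_not_mem hE hgeo l h)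
  refine ⟨hfin.subset hsupp, fun l hl => (hsupp hl).2.1, fun c => ?_⟩
  rw [cornerObs_eq_sum hE hgeo hδpos.ne' c hfin.toFinset (by rw [Set.Finite.coe_toFinset])]
  congr 1
  refine (finsum_eq_sum_of_support_subset _ ?_).symm
  rw [Set.Finite.coe_toFinset]
  exact (Function.support_mul_subset_left _ _).trans hsupp


end Summit.CriticalPhenomena.CardyFormulaZ2.Cruxes.EdgeCoherence.FixedRadiusCut

end
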